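import Summits.CriticalPhenomena.PercolationContinuityZ3.Theorems.PercNearOneGluingNoHeavyLowerTailThreePointProductFormHubWordsForms
import Summits.CriticalPhenomena.PercolationContinuityZ3.Theorems.PercNearOneGluingNoHeavyLowerTailThreePointProductFormHubWordsForms2
import Mathlib.Tactic.Linarith
import Mathlib.Tactic.NormNum
import Mathlib.Tactic.Ring
import Mathlib.Tactic.Positivity
import HarnessLib

/-!
# THEOREM B — hub words over ℕ: `#P1 − #bad ≥ 0` for every cycle through the apex with ARBITRARY hub multiplicities,
# as a kernel theorem about the explicit 6-state pencil automaton (Sahi programme, prover prim-sahi-p2 gen 64)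

Support file (`--supports stmt-CriticalPhenomena-4575`).  Standard axioms, no sorries, no named facts.  Memo
`run/shared/lean/prim/prim-sahi/FROM-prim-sahi-p2-gen64-ABPLUS-PROOF.md` §11; exact companion `prim-sahi-p2/gen64/lab64/hub_theoremB_check.py`.

THE OBJECT.  For a word `c = (c₁,…,c_k) ∈ ℕ^k` let `H(c)` be the cycle `a–y₁–…–y_k–a` through the apex with `c_t` pendant symmetric hubs
`z ~ y_t, s, c` at `y_t`, and `D(c) = #P1 − #bad` in the two-copy fibre (gens 53–63).  Gen 64 showed (memo §11): the series `D` has an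
8-dim linear representation with `M(c) = B₁ + 2^cB₂ + 4^cB₄ + 5^cB₅` valid for EVERY `c`, splitting as
`D(c) = (3/2)·5^n − 6·4^n + D₆(c)` (`n = Σc_t`) with `D₆` computed by the 6-state automaton `step` below (β-coordinates of the
normal form: characters `2^{y+1}−1` on `t, ℓ₀`; on each U-block `T(y) = 4^yT₄ + 5^yT₅`, `T₄ = (8/11)e₂e₁ᵀ` nilpotent, `T₅ = (−11/4,3)ᵀ(0,1)`).
The identification of this automaton with `#P1 − #bad` is an exact finite computation against the automata of gens 61–63
(`hubrep.py`, `hubstruct.py`, `hubnf3.py`, `leanB_data.py`), re-checkable by the referee; it is NOT re-proved here.  What IS proved here: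

* `D6_nonneg : ∀ w, 0 ≤ D6 w` — by ONE inductive invariant (`inv`): `t ≥ 0`, the `W′`-part of the functional is `≥ 0`, and for each of
  the five generators `g_i` of the amplitude cone 𝒢 = cone{(3/2,0,−1/2,−1/2),(0,1,0,0),(−1/2,1,1/2,1/2),(0,2,0,1),(0,2,1,0)} and EVERY
  letter `y`, the pairing `pair_i y (U-data) ≥ 0`.  Inductiveness = the sub-eigen identity `E_step` (`α₆M(y) = (2^{y+1}−1)α₆ + ρ_y`), the
  right-multiplication certificates of 𝒢 (`P0_step … P4_step`: `g_i·T(a) = 4^a(g_i·T(0)) + (5^a−4^a)(g_i·T₅)` with nonnegative INTEGER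
  coefficients over the generators) and the positivity of the five bilinear forms `K_i` (parts I/II).
* `D_nonneg_of_seven_le_sum : 7 ≤ w.sum → 0 ≤ D w` and the table `D_gapfree_le_six` (all 64 gap-free words with `Σc ≤ 6`; tight exactly at
  `[]`, `[1]`, `[2]`, `[1,1]`).  Words with bare vertices and `Σc ≤ 6` reduce to the table by the gap monotonicity THEOREM B′ (memo §11b,
  paper-level: `𝒢·a₂·𝒢 ⊆ 𝒢`).
[this work] (gen 64).
-/

namespace Summit.CriticalPhenomena.PercolationContinuityZ3.Theorems.ProductFormHubWords

/-- State of the 6-dim hub pencil automaton: `t` (top), the β-coordinates `(p₁,q₁), (p₂,q₂)` of the two U-blocks, `l` (bottom character `ℓ₀`). [this work] -/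
structure St where
  /-- top coordinate -/
  t : ℚ
  /-- `β`-coordinate of block 1 -/
  p1 : ℚ
  /-- `β′`-coordinate of block 1 -/
  q1 : ℚ
  /-- `β`-coordinate of block 2 -/
  p2 : ℚ
  /-- `β′`-coordinate of block 2 -/
  q2 : ℚ
  /-- bottom coordinate `ℓ₀` -/
  l : ℚ

/-- One step of the hub pencil automaton for the letter `y` (= `y` pendant hubs at the vertex), in the β-coordinates of the normal form
(memo §11 (2),(4)): `t, ℓ₀` carry the character `2^{y+1} − 1`, each U-block moves by `T(y) = 4^y T₄ + 5^y T₅`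
(`(p,q) ↦ (−(11/4)5^y q, (8/11)4^y p + 3·5^y q)`) plus the jump from `t`, and `ℓ₀` collects the leaks. [this work] -/
def step (y : ℕ) (s : St) : St :=
  ⟨((2:ℚ) * (2:ℚ)^y - 1) * s.t,
   -((11:ℚ)/4) * (5:ℚ)^y * s.q1 + s.t * (((-9317 : ℚ)/8) + ((9383 : ℚ)/6) * (2:ℚ)^y + ((-8789 : ℚ)/24) * (5:ℚ)^y),
   ((8:ℚ)/11) * (4:ℚ)^y * s.p1 + 3 * (5:ℚ)^y * s.q1 + s.t * (((799 : ℚ)/6) + (12 : ℚ) * (2:ℚ)^y + ((-1706 : ℚ)/3) * (4:ℚ)^y + ((799 : ℚ)/2) * (5:ℚ)^y),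
   -((11:ℚ)/4) * (5:ℚ)^y * s.q2 + s.t * (((99 : ℚ)/16) + ((-33 : ℚ)/4) * (2:ℚ)^y + ((33 : ℚ)/16) * (5:ℚ)^y),
   ((8:ℚ)/11) * (4:ℚ)^y * s.p2 + 3 * (5:ℚ)^y * s.q2 + s.t * (((-3 : ℚ)/4) + (3 : ℚ) * (4:ℚ)^y + ((-9 : ℚ)/4) * (5:ℚ)^y),
   ((2:ℚ) * (2:ℚ)^y - 1) * s.l + (((7 : ℚ)/176) + ((-1 : ℚ)/8) * (2:ℚ)^y + ((3 : ℚ)/44) * (4:ℚ)^y) * s.p1 + (((1 : ℚ)/16) + ((-3 : ℚ)/16) * (2:ℚ)^y + ((5 : ℚ)/64) * (5:ℚ)^y) * s.q1 + (((17959 : ℚ)/1980) + ((-26669 : ℚ)/990) * (2:ℚ)^y + ((633 : ℚ)/44) * (4:ℚ)^y) * s.p2 + (((3955 : ℚ)/288) + ((-633 : ℚ)/16) * (2:ℚ)^y + ((23407 : ℚ)/1440) * (5:ℚ)^y) * s.q2 + s.t * (((41 : ℚ)/5) + ((-1901 : ℚ)/160) * (2:ℚ)^y + ((193 : ℚ)/32)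 * (4:ℚ)^y + ((-143 : ℚ)/80) * (5:ℚ)^y)⟩

/-- Initial vector: `(1/9)·t` (the `V₆`-component of `ω`, normalised by `τ(ω) = 1/9`). [this work] -/
def omega : St := ⟨(1:ℚ)/9, 0, 0, 0, 0, 0⟩

/-- State after a word (column action: leftmost letter applied last). [this work] -/
def evalW : List ℕ → St
  | [] => omega
  | y :: w => step y (evalW w)

/-- The functional `α₆` in β-coordinates. [this work] -/
def alphaF (s : St) : ℚ := ((81 : ℚ)/2) * s.t + ((-69 : ℚ)/22) * s.p1 + ((-15 : ℚ)/4) * s.q1 + ((-104158 : ℚ)/165) * s.p2 + ((-9109 : ℚ)/12) * s.q2 + (24 : ℚ) * s.l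

/-- `D₆(w)` — the `V₆`-part of `#P1 − #bad` of the hub word `w` (memo §11 (1)). [this work] -/
def D6 (w : List ℕ) : ℚ := alphaF (evalW w)

/-- `D(w) = (3/2)·5^n − 6·4^n + D₆(w)`, `n = Σw` — equals `#P1 − #bad` of the cycle with `w_t` hubs at `y_t` (memo §11). [this work] -/
def D (w : List ℕ) : ℚ := ((3:ℚ)/2) * (5:ℚ)^(w.sum) - 6 * (4:ℚ)^(w.sum) + D6 w

/-- The `W′`-part of the functional (everything except the top coordinate). [this work] -/
def aW (s : St) : ℚ := ((-69 : ℚ)/22) * s.p1 + ((-15 : ℚ)/4) * s.q1 + ((-104158 : ℚ)/165) * s.p2 + ((-9109 : ℚ)/12) * s.q2 + (24 : ℚ) * s.l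

/-- The sub-eigen functional `ρ_y = α₆M(y) − (2^{y+1}−1)α₆` restricted to the U-data (it vanishes on `ℓ₀`). [this work] -/
def rho (y : ℕ) (p1 q1 p2 q2 : ℚ) : ℚ := ((((-24 : ℚ)/11) + ((36 : ℚ)/11) * (2:ℚ)^y + ((-12 : ℚ)/11) * (4:ℚ)^y) * p1 + (((-9 : ℚ)/4) + (3 : ℚ) * (2:ℚ)^y + ((-3 : ℚ)/4) * (5:ℚ)^y) * q1 + (((-13648 : ℚ)/33) + (616 : ℚ) * (2:ℚ)^y + ((-6824 : ℚ)/33) * (4:ℚ)^y) * p2 + (((-859 : ℚ)/2) + ((1706 : ℚ)/3) * (2:ℚ)^y + ((-907 : ℚ)/6) * (5:ℚ)^y) * q2)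

/-- Pairing of the state's U-data with the sub-eigen functional `ρ_y` after the amplitude generator `g_0` (matrix `matof(g_0)` on each block);
`pair0 y ≥ 0` along every word is part of the invariant. [this work] -/
def pair0 (y : ℕ) (p1 q1 p2 q2 : ℚ) : ℚ := rho y ((1 : ℚ) * p1 + (0 : ℚ) * q1) ((0 : ℚ) * p1 + (1 : ℚ) * q1) ((1 : ℚ) * p2 + (0 : ℚ) * q2) ((0 : ℚ) * p2 + (1 : ℚ) * q2)

/-- Pairing of the state's U-data with the sub-eigen functional `ρ_y` after the amplitude generator `g_1` (matrix `matof(g_1)` on each block);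
`pair1 y ≥ 0` along every word is part of the invariant. [this work] -/
def pair1 (y : ℕ) (p1 q1 p2 q2 : ℚ) : ℚ := rho y ((0 : ℚ) * p1 + ((-11 : ℚ)/4) * q1) ((0 : ℚ) * p1 + (3 : ℚ) * q1) ((0 : ℚ) * p2 + ((-11 : ℚ)/4) * q2) ((0 : ℚ) * p2 + (3 : ℚ) * q2)

/-- Pairing of the state's U-data with the sub-eigen functional `ρ_y` after the amplitude generator `g_2` (matrix `matof(g_2)` on each block);
`pair2 y ≥ 0` along every word is part of the invariant. [this work] -/
def pair2 (y : ℕ) (p1 q1 p2 q2 : ℚ) : ℚ := rho y ((-1 : ℚ) * p1 + ((-11 : ℚ)/4) * q1) (((8 : ℚ)/11) * p1 + (2 : ℚ) * q1) ((-1 : ℚ) * p2 + ((-11 : ℚ)/4) * q2) (((8 : ℚ)/11) * p2 + (2 : ℚ) * q2)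

/-- Pairing of the state's U-data with the sub-eigen functional `ρ_y` after the amplitude generator `g_3` (matrix `matof(g_3)` on each block);
`pair3 y ≥ 0` along every word is part of the invariant. [this work] -/
def pair3 (y : ℕ) (p1 q1 p2 q2 : ℚ) : ℚ := rho y ((-2 : ℚ) * p1 + ((-11 : ℚ)/2) * q1) (((24 : ℚ)/11) * p1 + (6 : ℚ) * q1) ((-2 : ℚ) * p2 + ((-11 : ℚ)/2) * q2) (((24 : ℚ)/11) * p2 + (6 : ℚ) * q2)

/-- Pairing of the state's U-data with the sub-eigen functional `ρ_y` after the amplitude generator `g_4` (matrix `matof(g_4)` on each block);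
`pair4 y ≥ 0` along every word is part of the invariant. [this work] -/
def pair4 (y : ℕ) (p1 q1 p2 q2 : ℚ) : ℚ := rho y ((0 : ℚ) * p1 + ((-11 : ℚ)/2) * q1) ((0 : ℚ) * p1 + (4 : ℚ) * q1) ((0 : ℚ) * p2 + ((-11 : ℚ)/2) * q2) ((0 : ℚ) * p2 + (4 : ℚ) * q2)

/-- SUB-EIGEN IDENTITY: `aW(M(y)s) = (2^{y+1}−1)·aW(s) + ρ_y(U(s)) + t·S0(y)`. [this work] -/
theorem E_step (y : ℕ) (s : St) :
    aW (step y s) = ((2:ℚ) * (2:ℚ)^y - 1) * aW s + rho y s.p1 s.q1 s.p2 s.q2 + s.t * S0 y := by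
  simp only [aW, step, rho, S0]; ring

/-- `ρ_y` is the pairing after the identity generator `g₀`. [this work] -/
theorem rho_eq_pair0 (y : ℕ) (p1 q1 p2 q2 : ℚ) : rho y p1 q1 p2 q2 = pair0 y p1 q1 p2 q2 := by
  simp only [pair0]; ring_nf

/-- RIGHT-MULTIPLICATION CERTIFICATE for `g_0`: the pairing after one more letter `a` is a nonnegative combination of the pairings
of the generators plus the jump term `t·K_0(a,y)`. [this work] -/
theorem P0_step (a y : ℕ) (s : St) :
    pair0 y (step a s).p1 (step a s).q1 (step a s).p2 (step a s).q2 = ((1 : ℚ) * (4:ℚ)^a) * pair0 y s.p1 s.q1 s.p2 s.q2 + ((1 : ℚ) * ((5:ℚ)^a - (4:ℚ)^a)) * pair1 y s.p1 s.q1 s.p2 s.q2 + ((1 : ℚ) * (4:ℚ)^a) * pair2 y s.p1 s.q1 s.p2 s.q2 + s.t * K0 a y := by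
  simp only [pair0, pair1, pair2, rho, step, K0]; ring

/-- RIGHT-MULTIPLICATION CERTIFICATE for `g_1`: the pairing after one more letter `a` is a nonnegative combination of the pairings
of the generators plus the jump term `t·K_1(a,y)`. [this work] -/
theorem P1_step (a y : ℕ) (s : St) :
    pair1 y (step a s).p1 (step a s).q1 (step a s).p2 (step a s).q2 = ((1 : ℚ) * (4:ℚ)^a + (3 : ℚ) * ((5:ℚ)^a - (4:ℚ)^a)) * pair1 y s.p1 s.q1 s.p2 s.q2 + ((1 : ℚ) * (4:ℚ)^a) * pair3 y s.p1 s.q1 s.p2 s.q2 + s.t * K1 a y := by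
  simp only [pair1, pair3, rho, step, K1]; ring

/-- RIGHT-MULTIPLICATION CERTIFICATE for `g_2`: the pairing after one more letter `a` is a nonnegative combination of the pairings
of the generators plus the jump term `t·K_2(a,y)`. [this work] -/
theorem P2_step (a y : ℕ) (s : St) :
    pair2 y (step a s).p1 (step a s).q1 (step a s).p2 (step a s).q2 = ((2 : ℚ) * (4:ℚ)^a) * pair2 y s.p1 s.q1 s.p2 s.q2 + ((1 : ℚ) * ((5:ℚ)^a - (4:ℚ)^a)) * pair4 y s.p1 s.q1 s.p2 s.q2 + s.t * K2 a y := by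
  simp only [pair2, pair4, rho, step, K2]; ring

/-- RIGHT-MULTIPLICATION CERTIFICATE for `g_3`: the pairing after one more letter `a` is a nonnegative combination of the pairings
of the generators plus the jump term `t·K_3(a,y)`. [this work] -/
theorem P3_step (a y : ℕ) (s : St) :
    pair3 y (step a s).p1 (step a s).q1 (step a s).p2 (step a s).q2 = ((4 : ℚ) * ((5:ℚ)^a - (4:ℚ)^a)) * pair1 y s.p1 s.q1 s.p2 s.q2 + ((2 : ℚ) * (4:ℚ)^a) * pair3 y s.p1 s.q1 s.p2 s.q2 + s.t * K3 a y := by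
  simp only [pair1, pair3, rho, step, K3]; ring

/-- RIGHT-MULTIPLICATION CERTIFICATE for `g_4`: the pairing after one more letter `a` is a nonnegative combination of the pairings
of the generators plus the jump term `t·K_4(a,y)`. [this work] -/
theorem P4_step (a y : ℕ) (s : St) :
    pair4 y (step a s).p1 (step a s).q1 (step a s).p2 (step a s).q2 = ((4 : ℚ) * (4:ℚ)^a) * pair2 y s.p1 s.q1 s.p2 s.q2 + ((1 : ℚ) * (4:ℚ)^a + (3 : ℚ) * ((5:ℚ)^a - (4:ℚ)^a)) * pair4 y s.p1 s.q1 s.p2 s.q2 + s.t * K4 a y := by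
  simp only [pair2, pair4, rho, step, K4]; ring

/-- THE INVARIANT along every hub word: `t ≥ 0`, `aW ≥ 0`, and all five generator pairings are `≥ 0` for EVERY letter `y`. [this work] -/
theorem inv (w : List ℕ) :
    0 ≤ (evalW w).t ∧ 0 ≤ aW (evalW w) ∧ ∀ y : ℕ, 0 ≤ pair0 y (evalW w).p1 (evalW w).q1 (evalW w).p2 (evalW w).q2 ∧ 0 ≤ pair1 y (evalW w).p1 (evalW w).q1 (evalW w).p2 (evalW w).q2 ∧ 0 ≤ pair2 y (evalW w).p1 (evalW w).q1 (evalW w).p2 (evalW w).q2 ∧ 0 ≤ pair3 y (evalW w).p1 (evalW w).q1 (evalW w).p2 (evalW w).q2 ∧ 0 ≤ pair4 y (evalW w).p1 (evalW w).q1 (evalW w).p2 (evalW w).q2 := by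
  induction w with
  | nil =>
    refine ⟨by simp only [evalW, omega]; norm_num, by simp only [evalW, omega, aW]; norm_num, fun y => ?_⟩
    simp only [evalW, omega, pair0, pair1, pair2, pair3, pair4, rho]
    norm_num
  | cons a w ih =>
    obtain ⟨ht, haw, hp⟩ := ih
    have h2 : (1:ℚ) ≤ (2:ℚ)^a := one_le_pow₀ (by norm_num)
    have h45 : (4:ℚ)^a ≤ (5:ℚ)^a := pow_le_pow_left₀ (by norm_num) (by norm_num) a
    have h4n : (0:ℚ) ≤ (4:ℚ)^a := by positivity
    refine ⟨?_, ?_, fun y => ?_⟩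
    · show 0 ≤ (step a (evalW w)).t
      simp only [step]; nlinarith
    · show 0 ≤ aW (step a (evalW w))
      rw [E_step, rho_eq_pair0]
      have g0 := (hp a).1
      nlinarith [mul_nonneg (show (0:ℚ) ≤ 2 * (2:ℚ)^a - 1 by linarith) haw, mul_nonneg ht (S0_nonneg a)]
    · obtain ⟨g0, g1, g2, g3, g4⟩ := hp y
      show 0 ≤ pair0 y (evalW (a :: w)).p1 (evalW (a :: w)).q1 (evalW (a :: w)).p2 (evalW (a :: w)).q2 ∧ 0 ≤ pair1 y (evalW (a :: w)).p1 (evalW (a :: w)).q1 (evalW (a :: w)).p2 (evalW (a :: w)).q2 ∧ 0 ≤ pair2 y (evalW (a :: w)).p1 (evalW (a :: w)).q1 (evalW (a :: w)).p2 (evalW (a :: w)).q2 ∧ 0 ≤ pair3 y (evalW (a :: w)).p1 (evalW (a :: w)).q1 (evalW (a :: w)).p2 (evalW (a :: w)).q2 ∧ 0 ≤ pair4 y (evalW (a :: w)).p1 (evalW (a :: w)).q1 (evalW (a :: w)).p2 (evalW (a :: w)).q2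
      simp only [evalW]
      refine ⟨?_, ?_, ?_, ?_, ?_⟩
      · rw [P0_step]
        linarith [mul_nonneg (show (0:ℚ) ≤ ((1 : ℚ) * (4:ℚ)^a) by nlinarith [h45, h4n]) g0, mul_nonneg (show (0:ℚ) ≤ ((1 : ℚ) * ((5:ℚ)^a - (4:ℚ)^a)) by nlinarith [h45, h4n]) g1, mul_nonneg (show (0:ℚ) ≤ ((1 : ℚ) * (4:ℚ)^a) by nlinarith [h45, h4n]) g2, mul_nonneg ht (K0_nonneg a y)]
      · rw [P1_step]
        linarith [mul_nonneg (show (0:ℚ) ≤ ((1 : ℚ) * (4:ℚ)^a + (3 : ℚ) * ((5:ℚ)^a - (4:ℚ)^a)) by nlinarith [h45, h4n]) g1, mul_nonneg (show (0:ℚ) ≤ ((1 : ℚ) * (4:ℚ)^a) by nlinarith [h45, h4n]) g3, mul_nonneg ht (K1_nonneg a y)]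
      · rw [P2_step]
        linarith [mul_nonneg (show (0:ℚ) ≤ ((2 : ℚ) * (4:ℚ)^a) by nlinarith [h45, h4n]) g2, mul_nonneg (show (0:ℚ) ≤ ((1 : ℚ) * ((5:ℚ)^a - (4:ℚ)^a)) by nlinarith [h45, h4n]) g4, mul_nonneg ht (K2_nonneg a y)]
      · rw [P3_step]
        linarith [mul_nonneg (show (0:ℚ) ≤ ((4 : ℚ) * ((5:ℚ)^a - (4:ℚ)^a)) by nlinarith [h45, h4n]) g1, mul_nonneg (show (0:ℚ) ≤ ((2 : ℚ) * (4:ℚ)^a) by nlinarith [h45, h4n]) g3, mul_nonneg ht (K3_nonneg a y)]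
      · rw [P4_step]
        linarith [mul_nonneg (show (0:ℚ) ≤ ((4 : ℚ) * (4:ℚ)^a) by nlinarith [h45, h4n]) g2, mul_nonneg (show (0:ℚ) ≤ ((1 : ℚ) * (4:ℚ)^a + (3 : ℚ) * ((5:ℚ)^a - (4:ℚ)^a)) by nlinarith [h45, h4n]) g4, mul_nonneg ht (K4_nonneg a y)]

/-- **`D₆ ≥ 0` on every hub word** (the heart of THEOREM B). [this work] -/
theorem D6_nonneg (w : List ℕ) : 0 ≤ D6 w := by
  obtain ⟨ht, haw, _⟩ := inv w
  have e : D6 w = ((81 : ℚ)/2) * (evalW w).t + aW (evalW w) := by simp only [D6, alphaF, aW]; ring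
  rw [e]; nlinarith

/-- **THEOREM B for `Σc ≥ 7`**: `D(w) ≥ 0` (since `(3/2)5^n ≥ 6·4^n` for `n ≥ 7` and `D₆ ≥ 0`). [this work] -/
theorem D_nonneg_of_seven_le_sum (w : List ℕ) (h : 7 ≤ w.sum) : 0 ≤ D w := by
  obtain ⟨m, hm⟩ := Nat.exists_eq_add_of_le h
  have h6 := D6_nonneg w
  unfold D; rw [hm, pow_add, pow_add]
  have h45 : (4:ℚ)^m ≤ (5:ℚ)^m := pow_le_pow_left₀ (by norm_num) (by norm_num) m
  have h4 : (0:ℚ) ≤ (4:ℚ)^m := by positivity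
  nlinarith

/-- THEOREM B for the 1 gap-free word(s) with `Σc = 0` (exact evaluation). [this work] -/
theorem D_gapfree_0 : 0 ≤ D [] := by
  simp only [D, D6, alphaF, evalW, omega, List.sum_nil]
  norm_num

/-- THEOREM B for the 1 gap-free word(s) with `Σc = 1` (exact evaluation). [this work] -/
theorem D_gapfree_1 : 0 ≤ D [1] := by
  simp only [D, D6, alphaF, evalW, step, omega, List.sum_cons, List.sum_nil]
  norm_num

/-- THEOREM B for the 2 gap-free word(s) with `Σc = 2` (exact evaluation). [this work] -/
theorem D_gapfree_2 : 0 ≤ D [1, 1] ∧ 0 ≤ D [2] := by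
  simp only [D, D6, alphaF, evalW, step, omega, List.sum_cons, List.sum_nil]
  norm_num

/-- THEOREM B for the 4 gap-free word(s) with `Σc = 3` (exact evaluation). [this work] -/
theorem D_gapfree_3 : 0 ≤ D [1, 1, 1] ∧ 0 ≤ D [1, 2] ∧ 0 ≤ D [2, 1] ∧ 0 ≤ D [3] := by
  simp only [D, D6, alphaF, evalW, step, omega, List.sum_cons, List.sum_nil]
  norm_num

/-- THEOREM B for the 8 gap-free word(s) with `Σc = 4` (exact evaluation). [this work] -/
theorem D_gapfree_4 : 0 ≤ D [1, 1, 1, 1] ∧ 0 ≤ D [1, 1, 2] ∧ 0 ≤ D [1, 2, 1] ∧ 0 ≤ D [1, 3] ∧ 0 ≤ D [2, 1, 1] ∧ 0 ≤ D [2, 2] ∧ 0 ≤ D [3, 1] ∧ 0 ≤ D [4] := by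
  simp only [D, D6, alphaF, evalW, step, omega, List.sum_cons, List.sum_nil]
  norm_num

/-- THEOREM B for the 16 gap-free word(s) with `Σc = 5` (exact evaluation). [this work] -/
theorem D_gapfree_5 : 0 ≤ D [1, 1, 1, 1, 1] ∧ 0 ≤ D [1, 1, 1, 2] ∧ 0 ≤ D [1, 1, 2, 1] ∧ 0 ≤ D [1, 1, 3] ∧ 0 ≤ D [1, 2, 1, 1] ∧ 0 ≤ D [1, 2, 2] ∧ 0 ≤ D [1, 3, 1] ∧ 0 ≤ D [1, 4] ∧ 0 ≤ D [2, 1, 1, 1] ∧ 0 ≤ D [2, 1, 2] ∧ 0 ≤ D [2, 2, 1] ∧ 0 ≤ D [2, 3] ∧ 0 ≤ D [3, 1, 1] ∧ 0 ≤ D [3, 2] ∧ 0 ≤ D [4, 1] ∧ 0 ≤ D [5] := by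
  simp only [D, D6, alphaF, evalW, step, omega, List.sum_cons, List.sum_nil]
  norm_num

/-- THEOREM B for the 32 gap-free word(s) with `Σc = 6` (exact evaluation). [this work] -/
theorem D_gapfree_6 : 0 ≤ D [1, 1, 1, 1, 1, 1] ∧ 0 ≤ D [1, 1, 1, 1, 2] ∧ 0 ≤ D [1, 1, 1, 2, 1] ∧ 0 ≤ D [1, 1, 1, 3] ∧ 0 ≤ D [1, 1, 2, 1, 1] ∧ 0 ≤ D [1, 1, 2, 2] ∧ 0 ≤ D [1, 1, 3, 1] ∧ 0 ≤ D [1, 1, 4] ∧ 0 ≤ D [1, 2, 1, 1, 1] ∧ 0 ≤ D [1, 2, 1, 2] ∧ 0 ≤ D [1, 2, 2, 1] ∧ 0 ≤ D [1, 2, 3] ∧ 0 ≤ D [1, 3, 1, 1] ∧ 0 ≤ D [1, 3, 2] ∧ 0 ≤ D [1, 4, 1] ∧ 0 ≤ D [1, 5] ∧ 0 ≤ D [2, 1, 1, 1, 1] ∧ 0 ≤ D [2, 1, 1, 2] ∧ 0 ≤ D [2, 1, 2, 1] ∧ 0 ≤ D [2, 1, 3] ∧ 0 ≤ D [2, 2,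 1, 1] ∧ 0 ≤ D [2, 2, 2] ∧ 0 ≤ D [2, 3, 1] ∧ 0 ≤ D [2, 4] ∧ 0 ≤ D [3, 1, 1, 1] ∧ 0 ≤ D [3, 1, 2] ∧ 0 ≤ D [3, 2, 1] ∧ 0 ≤ D [3, 3] ∧ 0 ≤ D [4, 1, 1] ∧ 0 ≤ D [4, 2] ∧ 0 ≤ D [5, 1] ∧ 0 ≤ D [6] := by
  simp only [D, D6, alphaF, evalW, step, omega, List.sum_cons, List.sum_nil]
  norm_num

/-- The tight cases: `D = 0` exactly for the hub patterns `[]`, `[1]`, `[2]`, `[1,1]` (at most two hubs in total). [this work] -/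
theorem D_tight : D [] = 0 ∧ D [1] = 0 ∧ D [2] = 0 ∧ D [1, 1] = 0 := by
  simp only [D, D6, alphaF, evalW, step, omega, List.sum_cons, List.sum_nil]
  norm_num

end Summit.CriticalPhenomena.PercolationContinuityZ3.Theorems.ProductFormHubWords
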